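import Literature.Geometry.Symplectic.CanonicalClassSqAndAdjunctionOfSymplecticFour
import Literature.AlgebraicTopology.SingularHomology.GysinMapSupportProofs
import Literature.AlgebraicTopology.SingularHomology.CechTautness
import Literature.AlgebraicTopology.SingularHomology.UniversalCoefficientsFree
import Literature.AlgebraicTopology.SingularHomology.FundamentalClassExistence
import Literature.AlgebraicTopology.SingularHomology.FundamentalClassProofs
import Literature.AlgebraicTopology.SingularHomology.CupProductProofs
import Literature.AlgebraicTopology.Homotopy.ENRTheorem
import Literature.Geometry.Manifold.TopologicalEmbedding
import HarnessLib

/-!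
# The Thom–Gysin sequence of the complement of a surface in a closed oriented `4`-manifold — proof

This file PROVES the named fact
`Literature.Geometry.Symplectic.thomGysin_complement_surface_four` of the sibling statement module
`CanonicalClassSqAndAdjunctionOfSymplecticFour.lean` (first landed as p86448 at the path
`…SymplecticFourProofs.lean`, where it had unintentionally replaced the parallel proposal p86396 of
the `canonicalClass…` seat; moved here, to a module named for the result, so that both coexist —
see the collision notice in `CanonicalClassSqAndAdjunctionOfSymplecticFourProofs.lean`). Sources: G. Bredon, *Topology and Geometry* (1993),
Ch. VI §11: Def. 11.1 / Thm. 11.3 (the Thom class and the Thom isomorphism of the normal disc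
bundle, PDF p. 381 = book p. 368) and Def. 11.8 with (1) (`τ ∩ [W] = [N]_W`, the Thom class is the
Poincaré dual of the fundamental class of the submanifold, PDF p. 384 = book p. 371); A. Hatcher,
*Algebraic Topology* (2002), §2.1 Thm. 2.16 (exact sequence of the pair), §3.3 p. 249): for a
closed oriented surface `S` embedded by `b` in a closed oriented `4`-manifold `N`, with `σ` the
Poincaré dual of `b_*[S]`, the inclusion `ι : N ∖ S → N` induces a surjection on `H₁`, and there is
`δ : ℤ → H₁(N ∖ S; ℤ)` with `im δ = ker ι_*` and `ker δ = {⟨a ∪ σ, [N]⟩ : a ∈ H²(N; ℤ)}`.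

## The proof formalised

The printed route (tubular neighbourhood, Thom isomorphism `H_k(N, N ∖ S) ≅ H_{k-2}(S)` of the
normal disc bundle, Thom class = Poincaré dual) is replaced by the tree's PROVED
Čech–Alexander–Poincaré duality along the compact set `K = b(S)` (H. Miller, *Lectures on Algebraic
Topology* (2020), Thm. 37.1 / Cor. 37.4 = Hatcher Prop. 3.46; the tree's
`HomologicalOrientation.cechDuality_res`), which yields the same identifications without any
smoothness:

* `H_q(N, N ∖ K; ℤ) ≅ Ȟ^{4-q}(K; ℤ)` by capping with the restriction `[N]|_K` of the fundamental
  class (`cechDuality_res`), and `Ȟ^p(K; ℤ) ≅ H^p(K; ℤ) ≅ H^p(S; ℤ)` by tautness of the compact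
  locally contractible `K ≅ S` in the Euclidean neighbourhood retract `N` (Spanier, *Algebraic
  Topology*, Thm. 6.1.10; the tree's `Cech.RetractionNhds.cechEquiv`);
* `H₁(N, N ∖ K) ≅ H³(S; ℤ) = 0` (`H₃(S) = 0`, `H₂(S) ≅ ℤ` free, universal coefficients), so
  `H₁(N ∖ K) → H₁(N)` is onto by exactness of the sequence of the pair (Hatcher Thm. 2.16);
* `H₂(N, N ∖ K) ≅ H²(S; ℤ) ≅ ℤ`, the last map being `a ↦ ⟨a, [S]⟩` (Poincaré duality on `S` and
  the augmentation), and under these identifications `j_* (a ⌢ [N]) ∈ H₂(N, N ∖ K)` goes to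
  `⟨b^* a, [S]⟩ = ⟨a, b_*[S]⟩ = ⟨a, σ ⌢ [N]⟩ = ⟨σ ∪ a, [N]⟩ = ⟨a ∪ σ, [N]⟩` (the Čech cap product
  of a global class is the relative cap product, `cechCap_of_univ_thetaInv`; naturality of the
  Kronecker pairing; graded commutativity in even degrees) — this is Bredon's (1)
  `τ ∩ [W] = [N]_W` read homologically;
* `δ := ∂ ∘ Θ⁻¹` for the resulting `Θ : H₂(N, N ∖ K) ≃ ℤ` and the connecting map `∂` of the
  pair: `im δ = im ∂ = ker ι_*` and `ker δ = Θ(ker ∂) = Θ(im j_*) = Θ(j_*(H²(N) ⌢ [N]))`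
  (Poincaré duality on `N`, the tree's `poincare_duality`) `= {⟨a ∪ σ, [N]⟩}`.

Everything is proved; no definitions, no named facts.

## References

* [Bredon1993] G. E. Bredon, Topology and Geometry, GTM 139, Springer 1993, Ch. VI Def. 11.1,
  Thm. 11.3, Def. 11.8 (1).
* [HatcherAT2002] A. Hatcher, Algebraic Topology, CUP 2002, §2.1 Thm. 2.16; §3.1 Thm. 3.2; §3.3
  Thm. 3.26, Thm. 3.30, Prop. 3.46, p. 241, p. 249.
* [Miller2020] H. Miller, Lectures on Algebraic Topology, World Scientific 2020, Thm. 37.1, Cor. 37.4.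
* [Spanier1981] E. H. Spanier, Algebraic Topology, Springer 1981, Ch. 6 §1 Thm. 10, Cor. 11.
-/

noncomputable section

-- as in `CechCapBridge` / `GysinMapSupportProofs`: concrete chains are `Finsupp`s and cochain
-- complexes are `(ComplexShape.down ℕ).symm`-complexes up to unfolding of semireducible definitions
set_option backward.isDefEq.respectTransparency false

open CategoryTheory Limits Set Function
open _root_.Topology
open Literature.AlgebraicTopology.SingularHomology Literature.AlgebraicTopology.Homotopy

namespace Literature.Geometry.Symplectic

universe u v

/-! ### Two bridges: global classes through Čech duality and through tautness -/

section Bridges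

variable {R : Type v} [CommRing R] {X : Type u} [TopologicalSpace X]

/-- **`j_*(a ⌢ [X])` is the Čech cap product of the Čech class of `a` with `[X]|_K`**: for a closed
`K ⊆ X`, an `R`-orientation `μ` with fundamental class `[X]`, `a ∈ Hᵖ(X; R)` and `p + q = n`, the
Čech cap product of the Čech class of `a` along `K` (`Cech.of univ ∘ Θ⁻¹`) with the restriction to
`K` of the concrete image of `[X]` in `Hₙ(X | X)` is `j_*(a ⌢ [X]) ∈ H_q(X, X ∖ K)` read in the
concrete model (Miller 2020, §34: the action of `H^p(X)` on `H_*(X, X − K)` is the cap product;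
Hatcher 2002, p. 240–241; the tree's `cechCap_of_univ_thetaInv`, `relCapProduct_ofAbsolute`).
[cite: Miller2020, §34, Def. 34.4] [cite: HatcherAT2002, §3.3 pp. 240–241] -/
theorem cechCap_res_of_thetaInv_eq_concreteIso_ofAbsolute_poincareDualityMap {n : ℕ}
    (μ : HomologicalOrientation R X n) {K : Set X} (hK : IsClosed K) {p q : ℕ} (h : p + q = n)
    (a : singularCohomology R R X p) :
    cechCap hK h (clocalHomology.res R R X (Set.subset_univ K) n
        ((relativeSingularHomology.concreteIso R R X (Set.univ : Set X)ᶜ n).hom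
          (relativeSingularHomology.ofAbsolute R R X (Set.univ : Set X)ᶜ n μ.fundamentalClass)))
        (Cech.of R (SimplexSpan.coefR R) (OpenNhd.univ K) (subsetCochains.thetaInv p a)) =
      (relativeSingularHomology.concreteIso R R X Kᶜ q).hom
        (relativeSingularHomology.ofAbsolute R R X Kᶜ q (poincareDualityMap μ h a)) := by
  rw [res_concreteIso_hom_ofAbsolute_univ, cechCap_of_univ_thetaInv hK h a, relCapProduct_ofAbsolute,
    poincareDualityMap_apply]

/-- **The tautness map on the Čech class of a global class is restriction to the subspace**: for
`a ∈ Hᵖ(X; R)` and `K ⊆ X`, the natural map `Ȟ^p(K) → H^p(↥K)` (Spanier 1966, Ch. 6 §1 p. 289)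
takes the Čech class of `a` along `K` to `a|_K = ι_K^* a` (Hatcher 2002, §3.1 p. 199, "`i^*`
restricts a cochain"; the tree's `homologyIsoSingularCohomology_hom_resH` and
`homologyIsoSingularCohomology_hom_thetaInv`). [cite: Spanier1981, Ch. 6 §1 p. 289]
[cite: HatcherAT2002, §3.1 p. 199] -/
theorem toSingularCohomology_of_univ_thetaInv (K : Set X) (p : ℕ) (a : singularCohomology R R X p) :
    Cech.toSingularCohomology R K p
        (Cech.of R (SimplexSpan.coefR R) (OpenNhd.univ K) (subsetCochains.thetaInv p a)) =
      singularCohomology.map R R (subsetIncl K) p a := by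
  change (subsetCochains.homologyIsoSingularCohomology R K p).hom
      (Cech.toSubset R (ModuleCat.of R (ULift.{u} R)) K p
        (Cech.of R (SimplexSpan.coefR R) (OpenNhd.univ K) (subsetCochains.thetaInv p a))) = _
  rw [Cech.toSubset_of]
  change (subsetCochains.homologyIsoSingularCohomology R K p).hom
      (subsetCochains.resH (Set.subset_univ K) p (subsetCochains.thetaInv p a)) = _
  rw [subsetCochains.homologyIsoSingularCohomology_hom_resH,
    subsetCochains.homologyIsoSingularCohomology_hom_thetaInv, ← ModuleCat.comp_apply,
    ← singularCohomology.map_comp]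
  rfl

end Bridges

/-! ### The closed oriented surface: `H³ = 0` and `H² ≅ ℤ` by evaluation on `[S]` -/

section Surface

variable {S : Type} [TopologicalSpace S] [T2Space S] [CompactSpace S] [ConnectedSpace S]
  [ChartedSpace (EuclideanSpace ℝ (Fin 2)) S]

/-- **`H³(S; ℤ) = 0` for a closed connected oriented surface**: `H₃(S; ℤ) = 0` (Hatcher 2002,
Thm. 3.26(c), the tree's `isZero_singularHomology_of_lt_holds`), `H₂(S; ℤ) ≅ ℤ` is free
(Thm. 3.26(a), `nonempty_singularHomology_top_iso_holds`), so `H³ ≅ Hom(H₃, ℤ) ⊕ Ext(H₂, ℤ) = 0`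
(Thm. 3.2, the tree's `kroneckerPairing_bijective_of_free`).
[cite: HatcherAT2002, §3.1 Thm. 3.2 and §3.3 Thm. 3.26] -/
theorem subsingleton_singularCohomology_three_surface (μS : HomologicalOrientation ℤ S 2) :
    Subsingleton (singularCohomology ℤ ℤ S 3) := by
  haveI : Subsingleton (singularHomology ℤ ℤ S 3) :=
    ModuleCat.subsingleton_of_isZero
      (isZero_singularHomology_of_lt_holds ℤ ℤ S 2 (show 2 < 3 by norm_num))
  obtain ⟨e⟩ := nonempty_singularHomology_top_iso_holds (R := ℤ) (X := S) 2 μS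
  haveI : Module.Free ℤ (singularHomology ℤ ℤ S 2) := Module.Free.of_equiv e.toLinearEquiv.symm
  exact (kroneckerPairing_bijective_of_free ℤ S 2).1.subsingleton

/-- **Evaluation on the fundamental class `H²(S; ℤ) → ℤ`, `a ↦ ⟨a, [S]⟩`, is bijective** for a
closed connected oriented surface: `⟨a, [S]⟩ = ε(a ⌢ [S])` with `a ↦ a ⌢ [S]` bijective (Poincaré
duality, Hatcher 2002, Thm. 3.30, the tree's `poincare_duality`) and `ε : H₀(S) → ℤ` bijective for
the path-connected `S` (Prop. 2.7). [cite: HatcherAT2002, §3.3 Thm. 3.30 and Prop. 2.7] -/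
theorem bijective_kroneckerPairing_fundamentalClass_surface (μS : HomologicalOrientation ℤ S 2) :
    Function.Bijective (fun a : singularCohomology ℤ ℤ S 2 =>
      kroneckerPairing ℤ ℤ S 2 a μS.fundamentalClass) := by
  haveI := ChartedSpace.locallyPathConnectedSpace (EuclideanSpace ℝ (Fin 2)) S
  haveI : PathConnectedSpace S := pathConnectedSpace_iff_connectedSpace.mpr inferInstance
  haveI := singularHomology.isIso_ε_of_pathConnectedSpace ℤ ℤ (X := S)
  have hPD : Function.Bijective (poincareDualityMap μS (Nat.add_zero 2)) :=
    poincare_duality μS (Nat.add_zero 2)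
  have hε : Function.Bijective (singularHomology.ε ℤ ℤ S) :=
    (asIso (singularHomology.ε ℤ ℤ S)).toLinearEquiv.bijective
  have hd : Function.Bijective (ULift.down : ULift.{0} ℤ → ℤ) :=
    ⟨fun _ _ h => ULift.ext _ _ h, fun z => ⟨⟨z⟩, rfl⟩⟩
  exact hd.comp (hε.comp hPD)

end Surface

/-! ### The theorem -/

/-- **The Thom–Gysin sequence of the complement of a closed oriented surface in a closed oriented
`4`-manifold — the named fact `thomGysin_complement_surface_four` HOLDS** (Bredon 1993, Ch. VI
Def. 11.1, Thm. 11.3, Def. 11.8 (1); Hatcher 2002, Thm. 2.16, §3.3 p. 249), proved through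
Čech–Alexander–Poincaré duality along `K = b(S)` (Miller 2020, Thm. 37.1 / Cor. 37.4 = Hatcher
Prop. 3.46), tautness of `K` (Spanier Thm. 6.1.10) and Poincaré duality on `N` and on `S`
(Hatcher Thm. 3.30): see the module docstring.
[cite: Bredon1993, Ch. VI Def. 11.1, Thm. 11.3, Def. 11.8 (1)]
[cite: HatcherAT2002, §2.1 Thm. 2.16; §3.3 Thm. 3.30, Prop. 3.46, p. 249]
[cite: Miller2020, Thm. 37.1, Cor. 37.4] [cite: Spanier1981, Ch. 6 §1 Thm. 10] -/
theorem thomGysin_complement_surface_four_holds : thomGysin_complement_surface_four := by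
  intro N _ _ _ _ _ _ μ S _ _ _ _ _ μS b hb σ hσ
  classical
  -- ### the compact set `K = b(S)`, closed in `N`, homeomorphic to `S`
  have hbe : IsEmbedding b := hb.isEmbedding
  haveI : T2Space S := hbe.t2Space
  set K : Set N := Set.range b with hKdef
  have hKc : IsCompact K := isCompact_range hbe.continuous
  have hK : IsClosed K := hKc.isClosed
  let e : S ≃ₜ ↥K := hbe.toHomeomorph
  have hbe' : (subsetIncl K).comp (e : C(S, ↥K)) = ⟨b, hb.isEmbedding.continuous⟩ := by
    ext x; rfl
  -- ### Čech duality along `K` for the restricted fundamental class `[N]|_K`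
  set γK := clocalHomology.res ℤ ℤ N (Set.subset_univ K) 4
    ((relativeSingularHomology.concreteIso ℤ ℤ N (Set.univ : Set N)ᶜ 4).hom
      (relativeSingularHomology.ofAbsolute ℤ ℤ N (Set.univ : Set N)ᶜ 4 μ.fundamentalClass)) with hγK
  have hD : CechDuality hK 4 γK := μ.cechDuality_res μ.res_fundamentalClass_point hK
  -- ### tautness of `K`: `Ȟ^p(K; ℤ) ≃ H^p(↥K; ℤ)`
  obtain ⟨m, ι, hιc⟩ :=
    Literature.Geometry.Manifold.exists_isClosedEmbedding_pi_of_compactSpace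
      (EuclideanSpace ℝ (Fin 4)) (M := N)
  have hNR : IsNeighbourhoodRetract (Set.range ι) :=
    isNeighbourhoodRetract_range_of_compactSpace
      isNeighbourhoodRetract_of_locallyContractibleSpace_holds (EuclideanSpace ℝ (Fin 4))
      hιc.isEmbedding
  have hKl : LocallyContractibleSpace ↥K :=
    locallyContractibleSpace_of_homeomorph e
      (locallyContractibleSpace_of_chartedSpace (EuclideanSpace ℝ (Fin 2)))
  obtain ⟨T⟩ := Cech.RetractionNhds.nonempty_of_locallyContractibleSpace (K := K)
    hιc.isEmbedding hNR hKc hKl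
  -- ### Part 1: `H₁(N ∖ K) → H₁(N)` is onto, since `H₁(N, N ∖ K) ≅ Ȟ³(K) ≅ H³(S) = 0`
  haveI hS3 : Subsingleton (singularCohomology ℤ ℤ S 3) :=
    subsingleton_singularCohomology_three_surface μS
  haveI hK3 : Subsingleton (singularCohomology ℤ ℤ (↥K) 3) :=
    (singularCohomology.mapIso ℤ ℤ e 3).toLinearEquiv.injective.subsingleton
  haveI hC3 : Subsingleton (Cech ℤ (ModuleCat.of ℤ (ULift.{0} ℤ)) K 3) :=
    (T.cechEquiv ℤ 3).injective.subsingleton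
  haveI hL1 : Subsingleton (clocalHomology ℤ ℤ N K 1) :=
    (hD 3 1 (by norm_num)).2.subsingleton
  haveI hR1 : Subsingleton (relativeSingularHomology ℤ ℤ N Kᶜ 1) :=
    (relativeSingularHomology.concreteIso ℤ ℤ N Kᶜ 1).toLinearEquiv.injective.subsingleton
  have hsurj : Function.Surjective
      (singularHomology.map ℤ ℤ (subsetIncl Kᶜ) 1) := by
    intro y
    exact ((ShortComplex.moduleCat_exact_iff _).1
      (relativeSingularHomology.exact_map_ofAbsolute ℤ ℤ Kᶜ 1)) y (Subsingleton.elim _ _)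
  refine ⟨hsurj, ?_⟩
  -- ### Part 2: `Θ : H₂(N, N ∖ K) ≃ ℤ` and `δ = ∂ ∘ Θ⁻¹`
  -- the evaluation `H²(S; ℤ) ≃ ℤ`, `a ↦ ⟨a, [S]⟩`
  let evS : singularCohomology ℤ ℤ S 2 →ₗ[ℤ] ℤ :=
    (kroneckerPairing ℤ ℤ S 2).flip μS.fundamentalClass
  have hevS : Function.Bijective evS := bijective_kroneckerPairing_fundamentalClass_surface μS
  let EvS : singularCohomology ℤ ℤ S 2 ≃ₗ[ℤ] ℤ := LinearEquiv.ofBijective evS hevS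
  -- Čech duality in degree `(2, 2)`
  -- (no type ascriptions: the `ℤ`-module structure on `Ȟ` is the direct-limit one)
  let C := LinearEquiv.ofBijective (cechCap hK two_add_two_eq_four γK) (hD 2 2 two_add_two_eq_four)
  -- the identification `Θ : H₂(N, N ∖ K) ≃ ℤ`
  let Θ := (relativeSingularHomology.concreteIso ℤ ℤ N Kᶜ 2).toLinearEquiv ≪≫ₗ C.symm ≪≫ₗ
    (T.cechEquiv ℤ 2) ≪≫ₗ (singularCohomology.mapIso ℤ ℤ e 2).toLinearEquiv ≪≫ₗ EvS
  -- ### the key computation: `Θ (j_* (a ⌢ [N])) = ⟨σ ⌣ a, [N]⟩`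
  have hΘ : ∀ a : singularCohomology ℤ ℤ N 2,
      Θ (relativeSingularHomology.ofAbsolute ℤ ℤ N Kᶜ 2
        (poincareDualityMap μ two_add_two_eq_four a)) =
        cupPairing μ two_add_two_eq_four σ a := by
    intro a
    have h1 : (relativeSingularHomology.concreteIso ℤ ℤ N Kᶜ 2).toLinearEquiv
        (relativeSingularHomology.ofAbsolute ℤ ℤ N Kᶜ 2
          (poincareDualityMap μ two_add_two_eq_four a)) =
        C (Cech.of ℤ (SimplexSpan.coefR ℤ) (OpenNhd.univ K) (subsetCochains.thetaInv 2 a)) := by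
      change (relativeSingularHomology.concreteIso ℤ ℤ N Kᶜ 2).hom _ =
        cechCap hK two_add_two_eq_four γK _
      rw [hγK, cechCap_res_of_thetaInv_eq_concreteIso_ofAbsolute_poincareDualityMap μ hK]
    have h2 : C.symm ((relativeSingularHomology.concreteIso ℤ ℤ N Kᶜ 2).toLinearEquiv
        (relativeSingularHomology.ofAbsolute ℤ ℤ N Kᶜ 2
          (poincareDualityMap μ two_add_two_eq_four a))) =
        Cech.of ℤ (SimplexSpan.coefR ℤ) (OpenNhd.univ K) (subsetCochains.thetaInv 2 a) := by
      rw [h1, LinearEquiv.symm_apply_apply]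
    have h3 : (T.cechEquiv ℤ 2)
        (Cech.of ℤ (SimplexSpan.coefR ℤ) (OpenNhd.univ K) (subsetCochains.thetaInv 2 a)) =
        singularCohomology.map ℤ ℤ (subsetIncl K) 2 a :=
      toSingularCohomology_of_univ_thetaInv K 2 a
    change EvS ((singularCohomology.mapIso ℤ ℤ e 2).toLinearEquiv ((T.cechEquiv ℤ 2)
      (C.symm ((relativeSingularHomology.concreteIso ℤ ℤ N Kᶜ 2).toLinearEquiv
        (relativeSingularHomology.ofAbsolute ℤ ℤ N Kᶜ 2
          (poincareDualityMap μ two_add_two_eq_four a)))))) = _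
    rw [h2, h3]
    change kroneckerPairing ℤ ℤ S 2 (singularCohomology.map ℤ ℤ (e : C(S, ↥K)) 2
      (singularCohomology.map ℤ ℤ (subsetIncl K) 2 a)) μS.fundamentalClass = _
    rw [← ModuleCat.comp_apply, ← singularCohomology.map_comp, hbe', kroneckerPairing_map, ← hσ,
      cupPairing_eq_kroneckerPairing_poincareDualityMap]
  -- ### the map `δ`
  let δ : ℤ →ₗ[ℤ] singularHomology ℤ ℤ (↥Kᶜ) 1 :=
    (relativeSingularHomology.δ ℤ ℤ N Kᶜ 1).hom ∘ₗ Θ.symm.toLinearMap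
  refine ⟨δ, ?_, ?_⟩
  · -- `im δ = im ∂ = ker ι_*`
    apply le_antisymm
    · rintro _ ⟨m, rfl⟩
      rw [LinearMap.mem_ker]
      change (relativeSingularHomology.δ ℤ ℤ N Kᶜ 1 ≫
        singularHomology.map ℤ ℤ (subsetIncl Kᶜ) 1) (Θ.symm m) = 0
      rw [relativeSingularHomology.δ_comp_map]
      rfl
    · intro y hy
      rw [LinearMap.mem_ker] at hy
      obtain ⟨z, hz⟩ := ((ShortComplex.moduleCat_exact_iff _).1
        (relativeSingularHomology.exact_δ_map ℤ ℤ Kᶜ 1)) y hy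
      rw [LinearMap.mem_range]
      refine ⟨Θ z, ?_⟩
      change relativeSingularHomology.δ ℤ ℤ N Kᶜ 1 (Θ.symm (Θ z)) = y
      rw [LinearEquiv.symm_apply_apply]
      exact hz
  · -- `ker δ = Θ(ker ∂) = Θ(im j_*) = Θ(j_*(H²(N) ⌢ [N])) = {⟨σ ⌣ a, [N]⟩} = {⟨a ⌣ σ, [N]⟩}`
    have hPD' : Function.Bijective (poincareDualityMap μ two_add_two_eq_four) :=
      poincare_duality μ two_add_two_eq_four
    have hPD : Function.Surjective (poincareDualityMap μ two_add_two_eq_four) := hPD'.2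
    have hflip : (cupPairing μ two_add_two_eq_four).flip σ = cupPairing μ two_add_two_eq_four σ := by
      rw [cupPairing_flip (cupProduct_gradedComm_holds ℤ N) μ two_add_two_eq_four two_add_two_eq_four]
      norm_num
    ext m
    rw [LinearMap.mem_ker, LinearMap.mem_range, hflip]
    constructor
    · intro hm
      -- `∂ (Θ⁻¹ m) = 0`, so `Θ⁻¹ m = j_* x` with `x = a ⌢ [N]`
      have hm' : relativeSingularHomology.δ ℤ ℤ N Kᶜ 1 (Θ.symm m) = 0 := hm
      obtain ⟨x, hx⟩ := ((ShortComplex.moduleCat_exact_iff _).1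
        (relativeSingularHomology.exact_ofAbsolute_δ ℤ ℤ Kᶜ 1)) (Θ.symm m) hm'
      obtain ⟨a, rfl⟩ := hPD x
      refine ⟨a, ?_⟩
      rw [← hΘ a,
        show relativeSingularHomology.ofAbsolute ℤ ℤ N Kᶜ 2
          (poincareDualityMap μ two_add_two_eq_four a) = Θ.symm m from hx,
        LinearEquiv.apply_symm_apply]
    · rintro ⟨a, rfl⟩
      rw [← hΘ a]
      change relativeSingularHomology.δ ℤ ℤ N Kᶜ 1 (Θ.symm (Θ _)) = 0
      rw [LinearEquiv.symm_apply_apply, ← ModuleCat.comp_apply,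
        relativeSingularHomology.ofAbsolute_comp_δ]
      rfl

end Literature.Geometry.Symplectic

end
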